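import Literature.MathematicalPhysics.StatisticalMechanics.BarlowStacking
import HarnessLib

/-!
# Line `c-layer-witness-strictness` (crux `SlackRigidity`, stmt-AtomisticToContinuum-11960):
# layering off the ideal ratio — part 1/4, planar hexagon lemmas

Stub `stub_layeringOffIdeal` of the line skeleton (exact Barlow 13-stars everywhere ⇒ one linearly
rotated Barlow stacking), part 1: the frame `u = (a,0,0)`, `v = (a/2, a√3/2, 0)`,
`w = (u+v)/3`, `e = (0,0,h)` of `BarlowStacking.lean` at general spacings `(a, h)`, its
coordinate and inner-product tables, and the one genuinely combinatorial planar fact used by the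
layering argument: a pair `g₁, g₂` of ADJACENT points (distance `a`) of the standard hexagon
`H = {±u, ±v, ±(u − v)}` generates the hexagon as `{g₁, g₂, −g₁, −g₂, g₁ − g₂, g₂ − g₁}` and its
hole point `(g₁ + g₂)/3` generates one of the two hole classes `±{w, w − u, w − v}` as
`{(g₁+g₂)/3, (g₁+g₂)/3 − g₁, (g₁+g₂)/3 − g₂}` (36-case check).  Potential-free Euclidean
geometry; all `[folklore]` (Hales, *Dense Sphere Packings* §1.3 for the picture).
-/

noncomputable section

namespace Summit.AtomisticToContinuum.Crystallization.Theorems.CLayerWitnessLayering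

open Literature.MathematicalPhysics.StatisticalMechanics RealInnerProductSpace

/-- Euclidean `3`-space. -/
local notation "E3" => EuclideanSpace ℝ (Fin 3)
set_option hygiene false in
/-- First in-layer generator `u = (a, 0, 0)` (the ambient `a`). -/
local notation "𝐮" => triangularVec₁ a
set_option hygiene false in
/-- Second in-layer generator `v = (a/2, a√3/2, 0)`. -/
local notation "𝐯" => triangularVec₂ a
set_option hygiene false in
/-- The hole offset `w = (u + v)/3`. -/
local notation "𝐰" => barlowOffset a
set_option hygiene false in
/-- The interlayer vector `h e₃` (the ambient `h`). -/
local notation "𝐞" => layerNormal h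
set_option hygiene false in
/-- The standard hexagon `H = {u, v, −u, −v, u − v, v − u}` (the six in-plane neighbours). -/
local notation "Hex" => ({triangularVec₁ a, triangularVec₂ a, -triangularVec₁ a, -triangularVec₂ a,
    triangularVec₁ a - triangularVec₂ a, triangularVec₂ a - triangularVec₁ a} :
      Set (EuclideanSpace ℝ (Fin 3)))

variable {a h : ℝ}

/-! ## Coordinates -/

/-- The inner product of `ℝ³` in coordinates. [folklore] -/
theorem inner_fin3 (x y : E3) : ⟪x, y⟫ = x 0 * y 0 + x 1 * y 1 + x 2 * y 2 := by
  simp [PiLp.inner_apply, Fin.sum_univ_three, mul_comm]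

/-- The squared norm of `ℝ³` in coordinates. [folklore] -/
theorem norm_sq_fin3 (x : E3) : ‖x‖ ^ 2 = x 0 ^ 2 + x 1 ^ 2 + x 2 ^ 2 := by
  rw [← real_inner_self_eq_norm_sq, inner_fin3]; ring

/-- The squared distance of `ℝ³` in coordinates. [folklore] -/
theorem dist_sq_fin3 (x y : E3) :
    dist x y ^ 2 = (x 0 - y 0) ^ 2 + (x 1 - y 1) ^ 2 + (x 2 - y 2) ^ 2 := by
  rw [EuclideanSpace.dist_sq_eq, Fin.sum_univ_three, Real.dist_eq, Real.dist_eq, Real.dist_eq,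
    sq_abs, sq_abs, sq_abs]

/-- `√3² = 3`. [folklore] -/
theorem sqrt_three_sq' : Real.sqrt 3 ^ 2 = 3 := Real.sq_sqrt (by norm_num)

/-- Coordinate of `u`. [folklore] -/
@[simp] theorem vecU_apply_zero : (𝐮 : E3) 0 = a := by simp [triangularVec₁]
/-- Coordinate of `u`. [folklore] -/
@[simp] theorem vecU_apply_one : (𝐮 : E3) 1 = 0 := by simp [triangularVec₁]
/-- Coordinate of `u`. [folklore] -/
@[simp] theorem vecU_apply_two : (𝐮 : E3) 2 = 0 := by simp [triangularVec₁]
/-- Coordinate of `v`. [folklore] -/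
@[simp] theorem vecV_apply_zero : (𝐯 : E3) 0 = a / 2 := by simp [triangularVec₂]
/-- Coordinate of `v`. [folklore] -/
@[simp] theorem vecV_apply_one : (𝐯 : E3) 1 = a * Real.sqrt 3 / 2 := by simp [triangularVec₂]
/-- Coordinate of `v`. [folklore] -/
@[simp] theorem vecV_apply_two : (𝐯 : E3) 2 = 0 := by simp [triangularVec₂]
/-- Coordinate of `w`. [folklore] -/
@[simp] theorem vecW_apply_zero : (𝐰 : E3) 0 = a / 2 := by simp [barlowOffset]
/-- Coordinate of `w`. [folklore] -/
@[simp] theorem vecW_apply_one : (𝐰 : E3) 1 = a * Real.sqrt 3 / 6 := by simp [barlowOffset]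
/-- Coordinate of `w`. [folklore] -/
@[simp] theorem vecW_apply_two : (𝐰 : E3) 2 = 0 := by simp [barlowOffset]
/-- Coordinate of `h e₃`. [folklore] -/
@[simp] theorem vecE_apply_zero : (𝐞 : E3) 0 = 0 := by simp [layerNormal]
/-- Coordinate of `h e₃`. [folklore] -/
@[simp] theorem vecE_apply_one : (𝐞 : E3) 1 = 0 := by simp [layerNormal]
/-- Coordinate of `h e₃`. [folklore] -/
@[simp] theorem vecE_apply_two : (𝐞 : E3) 2 = h := by simp [layerNormal]

/-- `w = (u + v)/3`. [folklore] -/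
theorem vecW_eq : (𝐰 : E3) = (1 / 3 : ℝ) • (𝐮 + 𝐯) := by
  ext i
  fin_cases i <;> simp <;> ring

/-! ## Inner-product table -/

/-- `⟪u, u⟫ = a²`. [folklore] -/
theorem inner_uu : ⟪(𝐮 : E3), 𝐮⟫ = a ^ 2 := by rw [inner_fin3]; simp; ring
/-- `⟪v, v⟫ = a²`. [folklore] -/
theorem inner_vv : ⟪(𝐯 : E3), 𝐯⟫ = a ^ 2 := by
  rw [inner_fin3]; simp; linear_combination (a ^ 2 / 4) * sqrt_three_sq'
/-- `⟪u, v⟫ = a²/2`. [folklore] -/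
theorem inner_uv : ⟪(𝐮 : E3), 𝐯⟫ = a ^ 2 / 2 := by rw [inner_fin3]; simp; ring
/-- `⟪v, u⟫ = a²/2`. [folklore] -/
theorem inner_vu : ⟪(𝐯 : E3), 𝐮⟫ = a ^ 2 / 2 := by rw [inner_fin3]; simp; ring
/-- `⟪w, u⟫ = a²/2`. [folklore] -/
theorem inner_wu : ⟪(𝐰 : E3), 𝐮⟫ = a ^ 2 / 2 := by rw [inner_fin3]; simp; ring
/-- `⟪u, w⟫ = a²/2`. [folklore] -/
theorem inner_uw : ⟪(𝐮 : E3), 𝐰⟫ = a ^ 2 / 2 := by rw [inner_fin3]; simp; ring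
/-- `⟪w, v⟫ = a²/2`. [folklore] -/
theorem inner_wv : ⟪(𝐰 : E3), 𝐯⟫ = a ^ 2 / 2 := by
  rw [inner_fin3]; simp; linear_combination (a ^ 2 / 12) * sqrt_three_sq'
/-- `⟪v, w⟫ = a²/2`. [folklore] -/
theorem inner_vw : ⟪(𝐯 : E3), 𝐰⟫ = a ^ 2 / 2 := by
  rw [inner_fin3]; simp; linear_combination (a ^ 2 / 12) * sqrt_three_sq'
/-- `⟪w, w⟫ = a²/3`. [folklore] -/
theorem inner_ww : ⟪(𝐰 : E3), 𝐰⟫ = a ^ 2 / 3 := by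
  rw [inner_fin3]; simp; linear_combination (a ^ 2 / 36) * sqrt_three_sq'
/-- `⟪e, u⟫ = 0`. [folklore] -/
@[simp] theorem inner_eu : ⟪(𝐞 : E3), 𝐮⟫ = 0 := by rw [inner_fin3]; simp
/-- `⟪u, e⟫ = 0`. [folklore] -/
@[simp] theorem inner_ue : ⟪(𝐮 : E3), 𝐞⟫ = 0 := by rw [inner_fin3]; simp
/-- `⟪e, v⟫ = 0`. [folklore] -/
@[simp] theorem inner_ev : ⟪(𝐞 : E3), 𝐯⟫ = 0 := by rw [inner_fin3]; simp
/-- `⟪v, e⟫ = 0`. [folklore] -/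
@[simp] theorem inner_ve : ⟪(𝐯 : E3), 𝐞⟫ = 0 := by rw [inner_fin3]; simp
/-- `⟪e, w⟫ = 0`. [folklore] -/
@[simp] theorem inner_ew : ⟪(𝐞 : E3), 𝐰⟫ = 0 := by rw [inner_fin3]; simp
/-- `⟪w, e⟫ = 0`. [folklore] -/
@[simp] theorem inner_we : ⟪(𝐰 : E3), 𝐞⟫ = 0 := by rw [inner_fin3]; simp
/-- `⟪e, e⟫ = h²`. [folklore] -/
theorem inner_ee : ⟪(𝐞 : E3), 𝐞⟫ = h ^ 2 := by rw [inner_fin3]; simp; ring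

/-- A vector of self-inner-product `a²` has norm `a` (`a ≥ 0`). [folklore] -/
theorem norm_eq_of_inner_self (ha : 0 ≤ a) {x : E3} (hx : ⟪x, x⟫ = a ^ 2) : ‖x‖ = a := by
  rw [real_inner_self_eq_norm_sq] at hx
  exact (sq_eq_sq₀ (norm_nonneg _) ha).1 hx

/-- A distance in terms of the self-inner-product of the difference. [folklore] -/
theorem dist_eq_of_inner_self (ha : 0 ≤ a) {x y : E3} (hx : ⟪x - y, x - y⟫ = a ^ 2) :
    dist x y = a := by
  rw [dist_eq_norm]; exact norm_eq_of_inner_self ha hx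

/-- The self-inner-product of a difference is the squared distance. [folklore] -/
theorem inner_self_sub_eq_dist_sq (x y : E3) : ⟪x - y, x - y⟫ = dist x y ^ 2 := by
  rw [real_inner_self_eq_norm_sq, dist_eq_norm]

/-! ## The hexagon -/

/-- The hexagon lies on the sphere of radius `a`: self-inner-products. [folklore] -/
theorem inner_self_of_mem_hex {x : E3} (hx : x ∈ Hex) : ⟪x, x⟫ = a ^ 2 := by
  simp only [Set.mem_insert_iff, Set.mem_singleton_iff] at hx
  rcases hx with rfl | rfl | rfl | rfl | rfl | rfl <;>
    simp only [inner_sub_left, inner_sub_right, inner_neg_left, inner_neg_right,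
      inner_uu, inner_uv, inner_vu, inner_vv] <;> ring

/-- The hexagon lies on the sphere of radius `a`. [folklore] -/
theorem norm_of_mem_hex (ha : 0 ≤ a) {x : E3} (hx : x ∈ Hex) : ‖x‖ = a :=
  norm_eq_of_inner_self ha (inner_self_of_mem_hex hx)

/-- The hexagon is horizontal. [folklore] -/
theorem apply_two_of_mem_hex {x : E3} (hx : x ∈ Hex) : x 2 = 0 := by
  simp only [Set.mem_insert_iff, Set.mem_singleton_iff] at hx
  rcases hx with rfl | rfl | rfl | rfl | rfl | rfl <;> simp

/-- The hexagon is orthogonal to `e₃`. [folklore] -/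
theorem inner_vecE_of_mem_hex {x : E3} (hx : x ∈ Hex) : ⟪(𝐞 : E3), x⟫ = 0 := by
  rw [inner_fin3, apply_two_of_mem_hex hx]; simp

/-- `u` and `v` are adjacent: `dist u v = a`. [folklore] -/
theorem dist_vecU_vecV (ha : 0 ≤ a) : dist (𝐮 : E3) 𝐯 = a := by
  apply dist_eq_of_inner_self ha
  simp only [inner_sub_left, inner_sub_right, inner_uu, inner_uv, inner_vu, inner_vv]; ring

/-- `−u` and `−v` are adjacent. [folklore] -/
theorem dist_neg_vecU_neg_vecV (ha : 0 ≤ a) : dist (-𝐮 : E3) (-𝐯) = a := by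
  rw [dist_neg_neg]; exact dist_vecU_vecV ha

/-- `u ∈ H`. [folklore] -/
theorem vecU_mem_hex : (𝐮 : E3) ∈ Hex := by simp
/-- `v ∈ H`. [folklore] -/
theorem vecV_mem_hex : (𝐯 : E3) ∈ Hex := by simp
/-- `−u ∈ H`. [folklore] -/
theorem neg_vecU_mem_hex : (-𝐮 : E3) ∈ Hex := by simp
/-- `−v ∈ H`. [folklore] -/
theorem neg_vecV_mem_hex : (-𝐯 : E3) ∈ Hex := by simp

/-! ## The hole points and the vertical direction -/

/-- The three hole points `w, w − u, w − v` have squared norm `a²/3`. [folklore] -/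
theorem inner_self_of_mem_holes {t : E3} (ht : t ∈ ({𝐰, 𝐰 - 𝐮, 𝐰 - 𝐯} : Set E3)) :
    ⟪t, t⟫ = a ^ 2 / 3 := by
  simp only [Set.mem_insert_iff, Set.mem_singleton_iff] at ht
  rcases ht with rfl | rfl | rfl <;>
    simp only [inner_sub_left, inner_sub_right, inner_ww, inner_wu, inner_uw, inner_uu, inner_wv,
      inner_vw, inner_vv] <;> ring

/-- The hole points are horizontal. [folklore] -/
theorem apply_two_of_mem_holes {t : E3} (ht : t ∈ ({𝐰, 𝐰 - 𝐮, 𝐰 - 𝐯} : Set E3)) : t 2 = 0 := by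
  simp only [Set.mem_insert_iff, Set.mem_singleton_iff] at ht
  rcases ht with rfl | rfl | rfl <;> simp

/-- The hole points are orthogonal to `e₃`. [folklore] -/
theorem inner_vecE_of_mem_holes {t : E3} (ht : t ∈ ({𝐰, 𝐰 - 𝐮, 𝐰 - 𝐯} : Set E3)) :
    ⟪(𝐞 : E3), t⟫ = 0 := by
  rw [inner_fin3, apply_two_of_mem_holes ht]; simp

/-- A lifted signed hole point `h e₃ + τ t` has squared norm `a²/3 + h²`. [folklore] -/
theorem inner_self_vecE_add_smul {τ : ℝ} (hτ : τ = 1 ∨ τ = -1) {t : E3}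
    (ht : t ∈ ({𝐰, 𝐰 - 𝐮, 𝐰 - 𝐯} : Set E3)) :
    ⟪(𝐞 : E3) + τ • t, 𝐞 + τ • t⟫ = a ^ 2 / 3 + h ^ 2 := by
  have hτ2 : τ * τ = 1 := by rcases hτ with rfl | rfl <;> norm_num
  have h1 := inner_vecE_of_mem_holes (h := h) ht
  have h2 : ⟪t, (𝐞 : E3)⟫ = 0 := by rw [real_inner_comm]; exact h1
  simp only [inner_add_left, inner_add_right, real_inner_smul_left, real_inner_smul_right,
    inner_ee, h1, h2, inner_self_of_mem_holes ht]
  linear_combination (a ^ 2 / 3) * hτ2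

/-- A lowered signed hole point `−h e₃ + τ t` has squared norm `a²/3 + h²`. [folklore] -/
theorem inner_self_neg_vecE_add_smul {τ : ℝ} (hτ : τ = 1 ∨ τ = -1) {t : E3}
    (ht : t ∈ ({𝐰, 𝐰 - 𝐮, 𝐰 - 𝐯} : Set E3)) :
    ⟪-(𝐞 : E3) + τ • t, -𝐞 + τ • t⟫ = a ^ 2 / 3 + h ^ 2 := by
  have hτ2 : τ * τ = 1 := by rcases hτ with rfl | rfl <;> norm_num
  have h1 := inner_vecE_of_mem_holes (h := h) ht
  have h2 : ⟪t, (𝐞 : E3)⟫ = 0 := by rw [real_inner_comm]; exact h1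
  simp only [inner_add_left, inner_add_right, real_inner_smul_left, real_inner_smul_right,
    inner_neg_left, inner_neg_right, inner_ee, h1, h2, inner_self_of_mem_holes ht]
  linear_combination (a ^ 2 / 3) * hτ2

/-- **The vertical direction**: a vector orthogonal to `u` and `v` of norm `h > 0` is `± h e₃`
(`a > 0`). [folklore] -/
theorem eq_vecE_or_of_inner (ha : 0 < a) (hh : 0 < h) {x : E3} (hu : ⟪x, (𝐮 : E3)⟫ = 0)
    (hv : ⟪x, (𝐯 : E3)⟫ = 0) (hn : ⟪x, x⟫ = h ^ 2) : x = 𝐞 ∨ x = -𝐞 := by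
  rw [inner_fin3, vecU_apply_zero, vecU_apply_one, vecU_apply_two, mul_zero, mul_zero, add_zero,
    add_zero] at hu
  have h0 : x 0 = 0 := (mul_eq_zero.1 hu).resolve_right ha.ne'
  rw [inner_fin3, vecV_apply_zero, vecV_apply_one, vecV_apply_two, h0, zero_mul, zero_add,
    mul_zero, add_zero] at hv
  have h3 : (0 : ℝ) < a * Real.sqrt 3 / 2 := by positivity
  have h1 : x 1 = 0 := (mul_eq_zero.1 hv).resolve_right h3.ne'
  rw [inner_fin3, h0, h1, mul_zero, zero_add, zero_add, sq] at hn
  have _ := hh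
  rcases mul_self_eq_mul_self_iff.1 hn with h2 | h2
  · left; ext i; fin_cases i <;> simp [h0, h1, h2]
  · right; ext i; fin_cases i <;> simp [h0, h1, h2]

/-- **The two hole classes are disjoint** (the instance used by the layering argument): if
`σ w = τ t` for signs `σ, τ` and a hole point `t ∈ {w, w − u, w − v}`, then `σ = τ` (`a > 0`).
[folklore] -/
theorem sign_eq_of_smul_vecW_eq (ha : 0 < a) {σ τ : ℝ} (hσ : σ = 1 ∨ σ = -1)
    (hτ : τ = 1 ∨ τ = -1) {t : E3} (ht : t ∈ ({𝐰, 𝐰 - 𝐮, 𝐰 - 𝐯} : Set E3))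
    (hst : σ • (𝐰 : E3) = τ • t) : σ = τ := by
  have has3 : 0 < a * Real.sqrt 3 := by positivity
  have h1 := congrArg (fun z : E3 => z 1) hst
  simp only [Set.mem_insert_iff, Set.mem_singleton_iff] at ht
  rcases hσ with rfl | rfl <;> rcases hτ with rfl | rfl <;> rcases ht with rfl | rfl | rfl
  all_goals first
    | rfl
    | (exfalso
       simp only [PiLp.smul_apply, PiLp.sub_apply, smul_eq_mul, vecW_apply_one, vecU_apply_one,
         vecV_apply_one] at h1
       linarith)

/-! ## Adjacent pairs of the hexagon -/

/-- **The twelve ordered adjacent pairs of the hexagon** (36-case check): two points of `H` at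
distance `a` (`a > 0`) are cyclic neighbours `u, v, v − u, −u, −v, u − v, u`. [folklore] -/
theorem adjacent_cases (ha : 0 < a) {g₁ g₂ : E3} (h₁ : g₁ ∈ Hex) (h₂ : g₂ ∈ Hex)
    (hd : dist g₁ g₂ = a) :
    (g₁ = 𝐮 ∧ g₂ = 𝐯) ∨ (g₁ = 𝐯 ∧ g₂ = 𝐮) ∨ (g₁ = 𝐯 ∧ g₂ = 𝐯 - 𝐮) ∨ (g₁ = 𝐯 - 𝐮 ∧ g₂ = 𝐯) ∨
    (g₁ = 𝐯 - 𝐮 ∧ g₂ = -𝐮) ∨ (g₁ = -𝐮 ∧ g₂ = 𝐯 - 𝐮) ∨ (g₁ = -𝐮 ∧ g₂ = -𝐯) ∨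
    (g₁ = -𝐯 ∧ g₂ = -𝐮) ∨ (g₁ = -𝐯 ∧ g₂ = 𝐮 - 𝐯) ∨ (g₁ = 𝐮 - 𝐯 ∧ g₂ = -𝐯) ∨
    (g₁ = 𝐮 - 𝐯 ∧ g₂ = 𝐮) ∨ (g₁ = 𝐮 ∧ g₂ = 𝐮 - 𝐯) := by
  have hd2 : ⟪g₁ - g₂, g₁ - g₂⟫ = a ^ 2 := by rw [inner_self_sub_eq_dist_sq, hd]
  have ha2 : 0 < a ^ 2 := by positivity
  simp only [Set.mem_insert_iff, Set.mem_singleton_iff] at h₁ h₂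
  rcases h₁ with rfl | rfl | rfl | rfl | rfl | rfl <;>
  rcases h₂ with rfl | rfl | rfl | rfl | rfl | rfl <;>
  simp only [inner_sub_left, inner_sub_right, inner_neg_left, inner_neg_right,
    inner_uu, inner_uv, inner_vu, inner_vv] at hd2
  all_goals first
    | (exfalso; linarith)
    | simp

/-- **An adjacent pair generates the hexagon**: if `g₁, g₂ ∈ H` are at distance `a` (`a > 0`)
then `H = {g₁, g₂, −g₁, −g₂, g₁ − g₂, g₂ − g₁}`. [folklore] -/
theorem layeringHex_eq_of_adjacent (ha : 0 < a) {g₁ g₂ : E3} (h₁ : g₁ ∈ Hex) (h₂ : g₂ ∈ Hex)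
    (hd : dist g₁ g₂ = a) : Hex = {g₁, g₂, -g₁, -g₂, g₁ - g₂, g₂ - g₁} := by
  have c1 : ∀ x y : E3, -x - (y - x) = -y := fun x y => by abel
  rcases adjacent_cases ha h₁ h₂ hd with ⟨rfl, rfl⟩ | ⟨rfl, rfl⟩ | ⟨rfl, rfl⟩ | ⟨rfl, rfl⟩ |
    ⟨rfl, rfl⟩ | ⟨rfl, rfl⟩ | ⟨rfl, rfl⟩ | ⟨rfl, rfl⟩ | ⟨rfl, rfl⟩ | ⟨rfl, rfl⟩ | ⟨rfl, rfl⟩ |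
    ⟨rfl, rfl⟩ <;>
  refine Set.Subset.antisymm ?_ ?_ <;>
  simp only [Set.insert_subset_iff, Set.singleton_subset_iff, Set.mem_insert_iff,
    Set.mem_singleton_iff, neg_neg, neg_sub, sub_sub_cancel, sub_sub_cancel_left, sub_neg_eq_add,
    sub_add_cancel, neg_add_eq_sub, c1, true_or, or_true, and_self]

/-- **An adjacent pair generates one hole class**: for `g₁, g₂ ∈ H` at distance `a` (`a > 0`),
the hole point `m = (g₁ + g₂)/3` together with `m − g₁, m − g₂` is one of the two hole classes
`τ • {w, w − u, w − v}`, `τ = ±1`. [folklore] -/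
theorem holes_of_adjacent (ha : 0 < a) {g₁ g₂ : E3} (h₁ : g₁ ∈ Hex) (h₂ : g₂ ∈ Hex)
    (hd : dist g₁ g₂ = a) :
    ∃ τ : ℝ, (τ = 1 ∨ τ = -1) ∧
      ({(1 / 3 : ℝ) • (g₁ + g₂), (1 / 3 : ℝ) • (g₁ + g₂) - g₁, (1 / 3 : ℝ) • (g₁ + g₂) - g₂} :
        Set E3) = {τ • 𝐰, τ • (𝐰 - 𝐮), τ • (𝐰 - 𝐯)} := by
  have hw : (𝐰 : E3) = (1 / 3 : ℝ) • (𝐮 + 𝐯) := vecW_eq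
  rw [hw]
  rcases adjacent_cases ha h₁ h₂ hd with ⟨rfl, rfl⟩ | ⟨rfl, rfl⟩ | ⟨rfl, rfl⟩ | ⟨rfl, rfl⟩ |
    ⟨rfl, rfl⟩ | ⟨rfl, rfl⟩ | ⟨rfl, rfl⟩ | ⟨rfl, rfl⟩ | ⟨rfl, rfl⟩ | ⟨rfl, rfl⟩ | ⟨rfl, rfl⟩ |
    ⟨rfl, rfl⟩
  all_goals first
    | (refine ⟨1, Or.inl rfl, Set.ext fun y => ?_⟩
       simp only [Set.mem_insert_iff, Set.mem_singleton_iff]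
       constructor <;> rintro (rfl | rfl | rfl) <;>
       first
       | exact Or.inl (by module)
       | exact Or.inr (Or.inl (by module))
       | exact Or.inr (Or.inr (by module))
       | fail "no disjunct")
    | (refine ⟨-1, Or.inr rfl, Set.ext fun y => ?_⟩
       simp only [Set.mem_insert_iff, Set.mem_singleton_iff]
       constructor <;> rintro (rfl | rfl | rfl) <;>
       first
       | exact Or.inl (by module)
       | exact Or.inr (Or.inl (by module))
       | exact Or.inr (Or.inr (by module)))


/-- **Registered sub-goal form** of `layeringHex_eq_of_adjacent` (closed statement, notations
expanded): two adjacent points of the standard hexagon generate it. [folklore] -/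
theorem layeringHex_hexagon_eq_of_adjacent :
    ∀ {a : ℝ}, 0 < a → ∀ {g₁ g₂ : EuclideanSpace ℝ (Fin 3)},
      g₁ ∈ ({triangularVec₁ a, triangularVec₂ a, -triangularVec₁ a, -triangularVec₂ a,
        triangularVec₁ a - triangularVec₂ a, triangularVec₂ a - triangularVec₁ a} :
          Set (EuclideanSpace ℝ (Fin 3))) →
      g₂ ∈ ({triangularVec₁ a, triangularVec₂ a, -triangularVec₁ a, -triangularVec₂ a,
        triangularVec₁ a - triangularVec₂ a, triangularVec₂ a - triangularVec₁ a} :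
          Set (EuclideanSpace ℝ (Fin 3))) →
      dist g₁ g₂ = a →
      ({triangularVec₁ a, triangularVec₂ a, -triangularVec₁ a, -triangularVec₂ a,
        triangularVec₁ a - triangularVec₂ a, triangularVec₂ a - triangularVec₁ a} :
          Set (EuclideanSpace ℝ (Fin 3))) = {g₁, g₂, -g₁, -g₂, g₁ - g₂, g₂ - g₁} :=
  fun ha _ _ h₁ h₂ hd => layeringHex_eq_of_adjacent ha h₁ h₂ hd

end Summit.AtomisticToContinuum.Crystallization.Theorems.CLayerWitnessLayering

end
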